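import Summits.KontsevichZagierPeriods.KontsevichZagierPeriods.Theorems.RootDecompWalshStrataQuadricWalls01

/-!
# The `z`-glue with affine walls, part 2/4: the wall family, its atoms, the wall box

Declarations `Quadric₃.wfam` … `inBaker_wallBox` of the farm-checked gen-7 file: the six-conic WALL FAMILY
`(D, p∘ℓ₁, 2Aℓ₁ + B, p∘ℓ₂, 2Aℓ₂ + B, g)`, the signs it fixes on an atom (`wfam_sign`), adaptedness
(`Dxy_eq_sq_of_wall`: `D = (2Aℓ + B)²` on `{p∘ℓ = 0}`), the DECISION of the clamp-into-`[ℓ₁, ℓ₂]` regimes of both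
roots on an atom (`kap_lo_cases`, `kap_hi_cases`), semialgebraic atoms `atomFam`, the base region `Wbase g`, the wall
box and `inBaker_wallBox` (rule (3) + `InBaker.quad_atomFam`).  See the module docstring of
`RootDecompWalshStrataQuadricWalls01` (part 1). [KontsevichZagier2001 §1.2; BCR1998 §2.2; this node gen 7]
-/

noncomputable section

open Literature.NumberTheory.Transcendental
open MeasureTheory Set
open MvPolynomial (aeval X C)
open Literature.ModelTheory.ExponentialFields (IsSemialgebraic isSemialgebraic_univ
  isSemialgebraic_setOf_eval_pos isSemialgebraic_setOf_eval_lt isSemialgebraic_setOf_eval_le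
  isSemialgebraic_setOf_eval_nonneg isSemialgebraic_setOf_eval_eq_zero
  isSemialgebraic_setOf_eval_ne_zero continuous_aeval_real tarski_seidenberg_real_holds)
open Summit.KontsevichZagierPeriods.RootDecompWalshStrata.WalshSpanProof (isSemialgebraic_cubeSet
  isBounded_cubeSet)
open Summit.KontsevichZagierPeriods.RootDecompWalshStrata.ConeSpecimen (unitIoo isSemialgebraic_unitIoo
  unitIoo_subset_Icc mem_unitIoo)
open Summit.KontsevichZagierPeriods.RootDecompWalshStrata.PointlessOctant (boxTwo isSemialgebraic_boxTwo
  boxTwo_subset_Icc)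

namespace Summit.KontsevichZagierPeriods.RootDecompWalshStrata.ConicDescent.BallCube

/-- `Fin.last 2 = 2` in `Fin 3` (PRIVATE copy of the CellThree01 helper; landed twin outside this chain,
gate lint `dedup.landed`). [folklore] -/
private theorem last_two₃ : (Fin.last 2 : Fin 3) = 2 := rfl

/-! #### 31.3 The wall family and its atoms -/

namespace Quadric₃

variable (K : Quadric₃)

/-- The WALL FAMILY of six conics of `K` with walls `ℓ₁ ≤ ℓ₂` over the base constraint `g > 0`:
`D`, `p∘ℓ₁`, `2Aℓ₁ + B`, `p∘ℓ₂`, `2Aℓ₂ + B`, `g`. -/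
def wfam (ℓ₁ ℓ₂ g : Wall) : Fin 6 → Conic
  | ⟨0, _⟩ => K.conic 0
  | ⟨1, _⟩ => (K.shiftW ℓ₁).conic 1
  | ⟨2, _⟩ => (K.shiftW ℓ₁).conic 3
  | ⟨3, _⟩ => (K.shiftW ℓ₂).conic 1
  | ⟨4, _⟩ => (K.shiftW ℓ₂).conic 3
  | ⟨_ + 5, _⟩ => g.toConic

/-- The six sign conditions on a wall-family atom, spelled out. [this node] -/
theorem wfam_sign (ℓ₁ ℓ₂ g : Wall) (σ : Fin 6 → SignType) {v : Fin 2 → ℝ}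
    (hv : v ∈ atomFam (K.wfam ℓ₁ ℓ₂ g) σ) :
    SignType.sign (K.Dxy (v 0) (v 1)) = σ 0 ∧
      SignType.sign ((K.shiftW ℓ₁).Cxy (v 0) (v 1)) = σ 1 ∧
      SignType.sign ((K.shiftW ℓ₁).Bxy (v 0) (v 1)) = σ 2 ∧
      SignType.sign ((K.shiftW ℓ₂).Cxy (v 0) (v 1)) = σ 3 ∧
      SignType.sign ((K.shiftW ℓ₂).Bxy (v 0) (v 1)) = σ 4 ∧
      SignType.sign (g.eval (v 0) (v 1)) = σ 5 := by
  obtain ⟨-, h⟩ := hv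
  refine ⟨?_, ?_, ?_, ?_, ?_, ?_⟩
  · rw [show K.Dxy (v 0) (v 1) = K.adapted 0 v from rfl, K.adapted_eq_conic]; exact h 0
  · rw [show (K.shiftW ℓ₁).Cxy (v 0) (v 1) = (K.shiftW ℓ₁).adapted 1 v from rfl,
      (K.shiftW ℓ₁).adapted_eq_conic]; exact h 1
  · rw [show (K.shiftW ℓ₁).Bxy (v 0) (v 1) = (K.shiftW ℓ₁).adapted 3 v from rfl,
      (K.shiftW ℓ₁).adapted_eq_conic]; exact h 2
  · rw [show (K.shiftW ℓ₂).Cxy (v 0) (v 1) = (K.shiftW ℓ₂).adapted 1 v from rfl,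
      (K.shiftW ℓ₂).adapted_eq_conic]; exact h 3
  · rw [show (K.shiftW ℓ₂).Bxy (v 0) (v 1) = (K.shiftW ℓ₂).adapted 3 v from rfl,
      (K.shiftW ℓ₂).adapted_eq_conic]; exact h 4
  · rw [← g.toConic_pxy]; exact h 5

/-- ADAPTEDNESS of the wall family: on the conic `{p∘ℓ = 0}` the discriminant is the square
`(2Aℓ + B)²` (genus 0 persists under every wall). [this node] -/
theorem Dxy_eq_sq_of_wall (ℓ : Wall) {x y : ℝ} (h : (K.shiftW ℓ).Cxy x y = 0) :
    K.Dxy x y = (K.shiftW ℓ).Bxy x y ^ 2 := by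
  rw [← K.shiftW_Dxy ℓ, Dxy, h, mul_zero, sub_zero]

/-- On a wall-family atom with `σ 0 ≠ 1` the discriminant is `≤ 0`, so `√D = 0`. [this node] -/
theorem sqrt_Dxy_eq_zero_of_wsign (ℓ₁ ℓ₂ g : Wall) (σ : Fin 6 → SignType) (hσ : σ 0 ≠ 1)
    {v : Fin 2 → ℝ} (hv : v ∈ atomFam (K.wfam ℓ₁ ℓ₂ g) σ) : √(K.Dxy (v 0) (v 1)) = 0 :=
  Real.sqrt_eq_zero'.2 (not_lt.1 fun h =>
    hσ ((K.wfam_sign ℓ₁ ℓ₂ g σ hv).1.symm.trans (sign_eq_one_iff.2 h)))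

/-- **Regimes of `lo` against the walls are decided by the atom** (`A < 0`, `σ 0 = 1`): on the atom,
`lo ≤ ℓ₁` everywhere, or `ℓ₂ ≤ lo` everywhere, or `ℓ₁ < lo < ℓ₂` everywhere. [this node] -/
theorem kap_lo_cases (hA : K.A < 0) (ℓ₁ ℓ₂ g : Wall) (σ : Fin 6 → SignType) (hσ : σ 0 = 1) :
    (∀ v ∈ atomFam (K.wfam ℓ₁ ℓ₂ g) σ, K.lo (v 0) (v 1) ≤ ℓ₁.eval (v 0) (v 1)) ∨
      (∀ v ∈ atomFam (K.wfam ℓ₁ ℓ₂ g) σ, ℓ₂.eval (v 0) (v 1) ≤ K.lo (v 0) (v 1)) ∨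
      (∀ v ∈ atomFam (K.wfam ℓ₁ ℓ₂ g) σ,
        ℓ₁.eval (v 0) (v 1) < K.lo (v 0) (v 1) ∧ K.lo (v 0) (v 1) < ℓ₂.eval (v 0) (v 1)) := by
  by_cases h1 : σ 2 = 1 ∧ σ 1 = -1
  · by_cases h2 : σ 4 = -1 ∨ σ 3 = 1
    · refine Or.inr (Or.inr fun v hv => ?_)
      obtain ⟨s0, s1, s2, s3, s4, -⟩ := K.wfam_sign ℓ₁ ℓ₂ g σ hv
      have hD : 0 < K.Dxy (v 0) (v 1) := sign_eq_one_iff.1 (s0.trans hσ)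
      refine ⟨(K.wall_lt_lo_iff hA ℓ₁ hD).2 ⟨sign_eq_one_iff.1 (s2.trans h1.1),
        sign_eq_neg_one_iff.1 (s1.trans h1.2)⟩, (K.lo_lt_wall_iff hA ℓ₂ hD).2 ?_⟩
      rcases h2 with h2 | h2
      · exact Or.inl (sign_eq_neg_one_iff.1 (s4.trans h2))
      · exact Or.inr (sign_eq_one_iff.1 (s3.trans h2))
    · refine Or.inr (Or.inl fun v hv => ?_)
      obtain ⟨s0, -, -, s3, s4, -⟩ := K.wfam_sign ℓ₁ ℓ₂ g σ hv
      have hD : 0 < K.Dxy (v 0) (v 1) := sign_eq_one_iff.1 (s0.trans hσ)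
      by_contra hlt
      rcases (K.lo_lt_wall_iff hA ℓ₂ hD).1 (not_le.1 hlt) with h | h
      · exact h2 (Or.inl (s4.symm.trans (sign_eq_neg_one_iff.2 h)))
      · exact h2 (Or.inr (s3.symm.trans (sign_eq_one_iff.2 h)))
  · refine Or.inl fun v hv => ?_
    obtain ⟨s0, s1, s2, -, -, -⟩ := K.wfam_sign ℓ₁ ℓ₂ g σ hv
    have hD : 0 < K.Dxy (v 0) (v 1) := sign_eq_one_iff.1 (s0.trans hσ)
    by_contra hlt
    obtain ⟨hB, hC⟩ := (K.wall_lt_lo_iff hA ℓ₁ hD).1 (not_le.1 hlt)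
    exact h1 ⟨s2.symm.trans (sign_eq_one_iff.2 hB), s1.symm.trans (sign_eq_neg_one_iff.2 hC)⟩

/-- **Regimes of `hi` against the walls are decided by the atom** (`A < 0`, `σ 0 = 1`). [this node] -/
theorem kap_hi_cases (hA : K.A < 0) (ℓ₁ ℓ₂ g : Wall) (σ : Fin 6 → SignType) (hσ : σ 0 = 1) :
    (∀ v ∈ atomFam (K.wfam ℓ₁ ℓ₂ g) σ, K.hi (v 0) (v 1) ≤ ℓ₁.eval (v 0) (v 1)) ∨
      (∀ v ∈ atomFam (K.wfam ℓ₁ ℓ₂ g) σ, ℓ₂.eval (v 0) (v 1) ≤ K.hi (v 0) (v 1)) ∨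
      (∀ v ∈ atomFam (K.wfam ℓ₁ ℓ₂ g) σ,
        ℓ₁.eval (v 0) (v 1) < K.hi (v 0) (v 1) ∧ K.hi (v 0) (v 1) < ℓ₂.eval (v 0) (v 1)) := by
  by_cases h1 : σ 2 = 1 ∨ σ 1 = 1
  · by_cases h2 : σ 4 = -1 ∧ σ 3 = -1
    · refine Or.inr (Or.inr fun v hv => ?_)
      obtain ⟨s0, s1, s2, s3, s4, -⟩ := K.wfam_sign ℓ₁ ℓ₂ g σ hv
      have hD : 0 < K.Dxy (v 0) (v 1) := sign_eq_one_iff.1 (s0.trans hσ)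
      refine ⟨(K.wall_lt_hi_iff hA ℓ₁ hD).2 ?_, (K.hi_lt_wall_iff hA ℓ₂ hD).2
        ⟨sign_eq_neg_one_iff.1 (s4.trans h2.1), sign_eq_neg_one_iff.1 (s3.trans h2.2)⟩⟩
      rcases h1 with h1 | h1
      · exact Or.inl (sign_eq_one_iff.1 (s2.trans h1))
      · exact Or.inr (sign_eq_one_iff.1 (s1.trans h1))
    · refine Or.inr (Or.inl fun v hv => ?_)
      obtain ⟨s0, -, -, s3, s4, -⟩ := K.wfam_sign ℓ₁ ℓ₂ g σ hv
      have hD : 0 < K.Dxy (v 0) (v 1) := sign_eq_one_iff.1 (s0.trans hσ)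
      by_contra hlt
      obtain ⟨hB, hC⟩ := (K.hi_lt_wall_iff hA ℓ₂ hD).1 (not_le.1 hlt)
      exact h2 ⟨s4.symm.trans (sign_eq_neg_one_iff.2 hB), s3.symm.trans (sign_eq_neg_one_iff.2 hC)⟩
  · refine Or.inl fun v hv => ?_
    obtain ⟨s0, s1, s2, -, -, -⟩ := K.wfam_sign ℓ₁ ℓ₂ g σ hv
    have hD : 0 < K.Dxy (v 0) (v 1) := sign_eq_one_iff.1 (s0.trans hσ)
    by_contra hlt
    rcases (K.wall_lt_hi_iff hA ℓ₁ hD).1 (not_le.1 hlt) with h | h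
    · exact h1 (Or.inl (s2.symm.trans (sign_eq_one_iff.2 h)))
    · exact h1 (Or.inr (s1.symm.trans (sign_eq_one_iff.2 h)))

end Quadric₃

/-- Sign atoms of a conic family are `ℚ`-semialgebraic. [BCR1998 §2.1] -/
theorem isSemialgebraic_atomFam {k : ℕ} (F : Fin k → Conic) (σ : Fin k → SignType) :
    IsSemialgebraic ℚ (atomFam F σ) := by
  classical
  have h := IsSemialgebraic.biInter (k := ℚ) (R := ℝ) (Finset.univ : Finset (Fin k))
    (fun i => {v : Fin 2 → ℝ | SignType.sign (aeval v (F i).pxyP) = σ i})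
    fun i _ => Quadric₃.isSemialgebraic_signSet _ _
  convert isSemialgebraic_boxTwo.inter h using 1
  ext v
  simp only [atomFam, boxTwo, mem_inter_iff, mem_setOf_eq, mem_iInter, Finset.mem_univ,
    Conic.aeval_pxyP, forall_true_left]

/-- Atoms of a conic family lie in the open square. [this node] -/
theorem atomFam_subset_boxTwo {k : ℕ} (F : Fin k → Conic) (σ : Fin k → SignType) :
    atomFam F σ ⊆ boxTwo := fun _ hv => hv.1

/-- Every point of the square lies in the atom of its own sign vector. [this node] -/
theorem mem_atomFam_sign {k : ℕ} (F : Fin k → Conic) {v : Fin 2 → ℝ} (hv : v ∈ boxTwo) :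
    v ∈ atomFam F fun i => SignType.sign ((F i).pxy (v 0) (v 1)) := ⟨hv, fun _ => rfl⟩

/-- Atoms with different sign vectors are disjoint. [this node] -/
theorem atomFam_eq_of_mem {k : ℕ} (F : Fin k → Conic) {σ τ : Fin k → SignType} {v : Fin 2 → ℝ}
    (h₁ : v ∈ atomFam F σ) (h₂ : v ∈ atomFam F τ) : σ = τ :=
  funext fun i => (h₁.2 i).symm.trans (h₂.2 i)

/-! #### 31.4 Wall boxes and wall cells; the case `A < 0` -/

/-- The base region `{v ∈ (0,1)² | g(v) > 0}`. -/
def Wbase (g : Wall) : Set (Fin 2 → ℝ) := {v | v ∈ boxTwo ∧ 0 < g.eval (v 0) (v 1)}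

/-- The base region lies in the open square. [this node] -/
theorem Wbase_subset_boxTwo (g : Wall) : Wbase g ⊆ boxTwo := fun _ hv => hv.1

/-- The base region is `ℚ`-semialgebraic. [BCR1998 §2.2] -/
theorem isSemialgebraic_Wbase (g : Wall) : IsSemialgebraic ℚ (Wbase g) := by
  convert isSemialgebraic_boxTwo.inter (isSemialgebraic_setOf_eval_pos (R := ℝ) g.toConic.pxyP) using 1
  ext v
  simp only [Wbase, mem_inter_iff, mem_setOf_eq, Conic.aeval_pxyP, Wall.toConic_pxy]

/-- The base region is the atom `sign g = 1` of the one-conic family `(g)`. [this node] -/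
theorem Wbase_eq_atomFam (g : Wall) : Wbase g = atomFam ![g.toConic] fun _ => 1 := by
  ext v
  simp only [Wbase, boxTwo, atomFam, mem_setOf_eq, Fin.forall_fin_one, Matrix.cons_val_zero,
    Wall.toConic_pxy, sign_eq_one_iff]

/-- The WALL BOX `(0,1)³ ∩ {g(x,y) > 0} ∩ {ℓ₁(x,y) < z < ℓ₂(x,y)}`. -/
def wallBox (ℓ₁ ℓ₂ g : Wall) : Set (Fin 3 → ℝ) :=
  {z | (∀ j, 0 < z j ∧ z j < 1) ∧ 0 < g.eval (z 0) (z 1) ∧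
    ℓ₁.eval (z 0) (z 1) < z 2 ∧ z 2 < ℓ₂.eval (z 0) (z 1)}

/-- Wall boxes are `ℚ`-semialgebraic. [BCR1998 §2.2] -/
theorem isSemialgebraic_wallBox (ℓ₁ ℓ₂ g : Wall) : IsSemialgebraic ℚ (wallBox ℓ₁ ℓ₂ g) := by
  convert (((isSemialgebraic_cubeSet 3).inter (isSemialgebraic_setOf_eval_pos (R := ℝ) g.P3)).inter
    (isSemialgebraic_setOf_eval_pos (R := ℝ) (X 2 - ℓ₁.P3))).inter
    (isSemialgebraic_setOf_eval_pos (R := ℝ) (ℓ₂.P3 - X 2)) using 1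
  ext z
  simp only [wallBox, mem_setOf_eq, mem_inter_iff, map_sub, Wall.aeval_P3, MvPolynomial.aeval_X,
    sub_pos, and_assoc]

/-- Wall boxes lie in the closed unit cube. [this node] -/
theorem wallBox_subset_Icc (ℓ₁ ℓ₂ g : Wall) : wallBox ℓ₁ ℓ₂ g ⊆ Icc 0 1 := fun _ hz =>
  ⟨fun j => (hz.1 j).1.le, fun j => (hz.1 j).2.le⟩

/-- **The wall box.** `[wallBox, q]` lands in the Baker sector (walls `0 ≤ ℓ₁ ≤ ℓ₂ ≤ 1` over the base):
a band over the base region (rule 3) with the affine length `q(ℓ₂ − ℓ₁)` on the atom `{g > 0}`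
(`InBaker.quad_atomFam`). [KontsevichZagier2001 §1.2 rule (3); this node] -/
theorem inBaker_wallBox (ℓ₁ ℓ₂ g : Wall)
    (hwall : ∀ v ∈ Wbase g, 0 ≤ ℓ₁.eval (v 0) (v 1) ∧
      ℓ₁.eval (v 0) (v 1) ≤ ℓ₂.eval (v 0) (v 1) ∧ ℓ₂.eval (v 0) (v 1) ≤ 1)
    (q : ℚ) (ρ : KZ.IntegralRep 3) (hdom : ρ.domain = wallBox ℓ₁ ℓ₂ g)
    (hint : ∀ z ∈ ρ.domain, ρ.integrand z = q) : InBaker (KZ.of ρ) := by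
  have hXs := isSemialgebraic_Wbase g
  have hXI : Wbase g ⊆ Icc 0 1 := fun v hv => boxTwo_subset_Icc hv.1
  have hdomeq : ρ.domain =
      oband (Wbase g) (fun v => ℓ₁.eval (v 0) (v 1)) fun v => ℓ₂.eval (v 0) (v 1) := by
    rw [hdom]
    ext z
    simp only [wallBox, Wbase, mem_setOf_eq, mem_oband, cube_iff, init₃_apply_zero,
      init₃_apply_one, last_two₃]
    constructor
    · rintro ⟨⟨h2, hz0, hz1⟩, hg, hl1, hl2⟩
      exact ⟨⟨h2, hg⟩, hl1, hl2⟩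
    · rintro ⟨⟨h2, hg⟩, hl1, hl2⟩
      obtain ⟨h0, h12, h1⟩ := hwall (Fin.init z) ⟨h2, hg⟩
      simp only [init₃_apply_zero, init₃_apply_one] at h0 h12 h1
      exact ⟨⟨h2, by linarith, by linarith⟩, hg, hl1, hl2⟩
  refine InBaker.of_band ρ (Wbase g) hXs hXI _ _ (ℓ₁.isSemialgebraicFunOn_eval hXs)
    (ℓ₂.isSemialgebraicFunOn_eval hXs) (fun v hv => (hwall v hv).1) (fun v hv => (hwall v hv).2.1)
    (fun v hv => (hwall v hv).2.2) q hdomeq hint ?_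
  refine InBaker.quad_atomFam ![g.toConic] (fun _ => 1) (Wall.lin q ℓ₂ (-q) ℓ₁).toConic _ ?_
    fun v _ => ?_
  · simp only [lenRep, bddRep_domain, Wbase_eq_atomFam]
  · simp only [lenRep, bddRep_integrand, Wall.toConic_pxy, Wall.lin_eval]
    push_cast; ring

end Summit.KontsevichZagierPeriods.RootDecompWalshStrata.ConicDescent.BallCube
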